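import Summits.BirchSwinnertonDyer.BirchSwinnertonDyer.Theses.InertBadSignedBranches
import Summits.BirchSwinnertonDyer.BirchSwinnertonDyer.Theorems.InertBadSignedBranchesInertBadAtThreeIstarZeroPeriodRatioOfMazur
import HarnessLib

/-!
# Route `InertBadSignedBranches` (rung K8): the D71 child `InertBadAtThreeIstarZero` IN THE ROUTE'S OWN
# VOCABULARY — modulo C-cc-1@3 (pair form) resp. (GZ_η-VAL)@3, the print readings at `3`, and the
# route's support item `PublishedFactsInert` VERBATIM (helper toward stmt-BirchSwinnertonDyer-19656;
# cell `b2b-bsdres`, seat x1b GEN 46, file 133; theorems only, nothing asserted)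

HONEST FRAMING (cell `b2b-bsdres`, run/shared/lean/b2b/bsd-rank1-residual/, verbatim in every file):
the goal of the cell is to DELETE the COMBINATION-SHAPED residual classes of the Birch–Swinnerton-Dyer
formula for ALL analytic-rank `≤ 1` elliptic curves over `ℚ` — "full BSD formula for every rank `≤ 1`
curve in class `C`" assembled STRICTLY from published theorems — so that the rank-`≤ 1` remainder
becomes exactly the CONSTRUCTION-SHAPED classes, which are TYPED (missing-input `Prop`s), NOT
attempted. This is not "finishing BSD". Research route; NO CLAIM BEYOND STATED CLASSES; the class
served (O10-PS@3 = X12 ∩ CM-inert ∩ Kodaira `I₀*` at `3`, 57 classes `N < 5·10⁵`) stays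
CONSTRUCTION-SHAPED and OPEN; nothing here changes a label or a mark. THEOREMS ONLY (0 definitions,
0 named facts minted, 0 `sorry`): the conclusions are the route item `InertBadAtThreeIstarZero` UNDER
DISPLAYED HYPOTHESES — the law at `3` in pair form / (GZ_η-VAL)@3, (C1_η)@3 and the readings at `3`
(conjecture / paper-grade, hypotheses only) and the route's support item `PublishedFactsInert`
(a conjunction of six PUBLISHED named facts incl. Mazur's `p ∤ c₀`; taken as a hypothesis, never
asserted). The item is NOT closed by this file (conditional result); nothing is booked.

PARTITION (D-0054): CornerF inert-bad sub-cell (B12 / O10; O10-PS@3) × the 57 rank-one classes of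
signed local type `(3, I₀*)` × `p = 3` — types-the-object-of / none: restates the D71 child as
"kernel modulo C-cc-1@3 ∧ readings@3 ∧ `PublishedFactsInert`" — LITERALLY the input list of the
`p ≥ 5` branch of the route's bridge `CMRungInputs.cmInertBad_of_inputs` (`h₁`, `h₅`, `h₆`), read at
`p = 3` (`p* = −3`: the minus / imaginary period; `ord₃ c₃(W) = 0` and `hper`@3 DISCHARGED inside, by
the seat bsd-cm-inert's CM Tamagawa lemma and by x1b's file 131 `periodRatio_three_of_mazur`); closes
no cell, books nothing, moves no mark.

## What is here

* `inertBadSignedBranches_inertBadAtThreeIstarZero_of_pairLawAtThree_of_readingsAtThree` —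
  `InertBadAtThreeIstarZero` ⟸ (h₁@3) C-cc-1@3 in pair form on the type ∧ (h₅@3) (C1_η)@3 on the CM
  good-inert curves ∧ ((R2)@3 typed + Kobayashi 7.4 (ii) exact reading at `3`) on the type ∧ (h₆)
  `PublishedFactsInert`;
* `inertBadSignedBranches_inertBadAtThreeIstarZero_of_etaGZValuationAtThree_of_readingsAtThree` — the
  same with (h₁@3) replaced by (GZ_η-VAL)@3 in print currency (log of the generator; the cell's own
  statement, PAPER from (GZ_η)@3 by memo N21 v1.2, referee PASS — a HYPOTHESIS here).
So the planner may, if it wishes, re-split the child into "law@3" ∧ "readings@3" cruxes with these two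
theorems as glue (the `p = 3` twins of `CccOneLawOnTypeIstarZero` / `PrintReadingsInert`); x1b files
no item (D-0014).

References (locators only): [Mazur1978] Cor. 4.1; [Kobayashi2003] §4 (p. 8), Thm. 7.4 (p. 13);
[KitajimaOtsuki2018] Main Thm. 1.3; [Miller2011LMS] §1, Def. 1.1; [SilvermanATAEC1994] IV.9.4,
Table 4.1.
-/

set_option autoImplicit false
set_option linter.dupNamespace false

noncomputable section

open scoped Classical MatrixGroups ModularForm NumberField

open CongruenceSubgroup Field NumberField IsDedekindDomain IsDedekindDomain.HeightOneSpectrum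
  WeierstrassCurve Rat.HeightOneSpectrum
open Literature.NumberTheory.EllipticCurves
open Literature.NumberTheory.EllipticCurves.ModularForms
open Literature.NumberTheory.EllipticCurves.Kobayashi2003 hiding IsQuadraticBranchMinusLFunction
open Literature.NumberTheory.EllipticCurves.Rank1Residual
open Literature.NumberTheory.EllipticCurves.Rank1Residual.Typed
open Literature.NumberTheory.GaloisRepresentations
open Literature.NumberTheory.GaloisCohomology
open Summit.BirchSwinnertonDyer.Rank1Residual
open Summit.BirchSwinnertonDyer.Rank1Residual.Additive
open Summit.BirchSwinnertonDyer.Rank1Residual.Additive.LocalLog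
open Summit.BirchSwinnertonDyer.Rank1Residual.X12.O10
open Summit.BirchSwinnertonDyer.BirchSwinnertonDyer.Theses.InertBadSignedBranches
open Summit.BirchSwinnertonDyer.BirchSwinnertonDyer.Theorems.InertBadOdd

namespace Summit.BirchSwinnertonDyer.BirchSwinnertonDyer.Theorems

/-- **The D71 child `InertBadAtThreeIstarZero` MODULO C-cc-1@3 (pair form) ∧ the print readings at `3`
∧ the route's support item `PublishedFactsInert`** (the `p = 3` reading of the bridge's `I₀*` branch:
`h₁` ↦ the law at `3` in pair form on the type, `h₅` ↦ (C1_η)@3 ∧ ((R2)@3, Kobayashi 7.4 (ii) exact at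
`3`), `h₆` verbatim; `ord₃ c₃(W) = 0` and the period datum are discharged inside —
`InertBadOdd.missingInputAt_IstarZero_three_of_pairLaw_of_readings_of_mazur`). CONDITIONAL on every
displayed hypothesis; the item stays open; nothing booked. [cite: Mazur1978, Cor. 4.1]
[cite: Kobayashi2003, §4 (p. 8), Thm. 7.4 (p. 13)] [cite: KitajimaOtsuki2018, Main Thm. 1.3 (arXiv:1607.03612 p. 3)]
[cite: SilvermanATAEC1994, IV.9.4 and Table 4.1] [cite: Miller2011LMS, §1 and Def. 1.1] -/
theorem inertBadSignedBranches_inertBadAtThreeIstarZero_of_pairLawAtThree_of_readingsAtThree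
    (h₁ : ∀ (W : WeierstrassCurve ℚ) [W.IsElliptic] [W.IsGloballyMinimal],
      HasSignedLocalType W 3 (.Istar 0) → W.analyticRank = 1 →
      ∀ (V : WeierstrassCurve ℚ) [V.IsElliptic] [V.IsGloballyMinimal] (C : VariableChange ℚ)
        {N : ℕ} [NeZero N] {f : CuspForm (Gamma0 N) 2},
        C • W.quadraticTwist (-3) = V →
        V.HasGoodReductionAtPrime 3 → V.frobeniusTrace 3 = 0 → IsNewformOf V f →
        ∀ (ϖ : ℚ), (ϖ : ℝ) * V.imaginaryPeriodRat = minusPeriod f →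
        ∀ (L : IwasawaAlgebra 3), IsQuadraticBranchMinusLFunction f 3 ϖ L →
        (∀ Q : (W.baseChange ℚ_[3]).toAffine.Point, 3 • Q = 0 → Q = 0) →
        ∀ (P : W.toAffine.Point) (n : ℕ), ¬ IsOfFinAddOrder P →
        (∀ R : W.toAffine.Point, ∃ (k : ℤ) (T : W.toAffine.Point), IsOfFinAddOrder T ∧ R = k • P + T) →
        (∃ Q : (W.baseChange ℚ_[3]).toAffine.Point, 3 ^ n • Q = W.toPadicPoint 3 P) →
        (∀ Q : (W.baseChange ℚ_[3]).toAffine.Point, 3 ^ (n + 1) • Q ≠ W.toPadicPoint 3 P) →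
        ∀ (q : ℚ), shaAn W = (q : ℂ) →
        PowerSeries.coeff 1 L ≠ 0 ∧
          ((PowerSeries.coeff 1 L : ℤ_[3]) : ℚ_[3]).valuation =
            2 * (n : ℤ) + padicValRat 3 (q * W.tamagawaProduct / (W.torsionOrder : ℚ) ^ 2))
    (h₅ : (∀ (V : WeierstrassCurve ℚ) [V.IsElliptic] [V.IsGloballyMinimal], V.HasCM →
        V.HasGoodReductionAtPrime 3 → CMInert V 3 → QuadraticBranchPlusMainConjectureAt V 3) ∧
      ∀ (W : WeierstrassCurve ℚ) [W.IsElliptic] [W.IsGloballyMinimal],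
        HasSignedLocalType W 3 (.Istar 0) → W.analyticRank = 1 →
        OddBranchStrictMinusNoFiniteSubmoduleAt W 3 ∧
        ∀ (V : WeierstrassCurve ℚ) [V.IsElliptic] [V.IsGloballyMinimal] (C : VariableChange ℚ)
          {N : ℕ} [NeZero N] {f : CuspForm (Gamma0 N) 2},
          (3 : ℕ) ≠ 2 → C • W.quadraticTwist (-3) = V →
          V.HasGoodReductionAtPrime 3 → V.frobeniusTrace 3 = 0 →
          QuadraticBranchPlusMainConjectureAt V 3 → IsNewformOf V f →
          ∀ (ϖ : ℚ), (ϖ : ℝ) * V.imaginaryPeriodRat = minusPeriod f →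
          ∀ (Lη : IwasawaAlgebra 3), IsQuadraticBranchMinusLFunction f 3 ϖ Lη →
          ∀ (κ : ZpExtension ℚ 3) (γ : Field.absoluteGaloisGroup ℚ),
            κ.IsCyclotomic → κ.IsTopGenerator γ → IsCyclotomicVariable 3 γ →
          ∀ (D : StrictSignedSelmerDualData W κ ℚ_[3] γ (-1)) (L' : IwasawaAlgebra 3),
            Lη = PowerSeries.X * L' → D.charIdeal = Ideal.span {L'})
    (h₆ : PublishedFactsInert) :
    InertBadAtThreeIstarZero := by
  obtain ⟨hmod, hGZ, hGZK, hPT, hnf, hM⟩ := h₆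
  obtain ⟨hC1, hRd⟩ := h₅
  intro W _ _ _ hT hr
  exact missingInputAt_IstarZero_three_of_pairLaw_of_readings_of_mazur hmod hGZ hGZK hPT hnf hM h₁ hRd
    hC1 W hT hr

/-- **The D71 child `InertBadAtThreeIstarZero` MODULO (GZ_η-VAL)@3 ∧ the print readings at `3` ∧ the
route's support item `PublishedFactsInert`** — the same with the law at `3` replaced by the η-branch
`p`-adic Gross–Zagier VALUATION identity at `3` in print currency (`coeff₁ L ≠ 0 ∧ v₃(coeff₁ L) =
2·ord₃ log_ω(P) + ord₃(L′(W,1)/(Ω_W·Reg W))`; the cell's own statement, PAPER from (GZ_η)@3, a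
HYPOTHESIS here) — `InertBadOdd.missingInputAt_IstarZero_three_of_etaGZValuation_of_readings_of_mazur`.
CONDITIONAL; the item stays open; nothing booked. [cite: Mazur1978, Cor. 4.1]
[cite: Kobayashi2003, §4 (p. 8), Thm. 7.4 (p. 13)] [cite: SilvermanAEC2009, IV.6.4 and VII.6.3]
[cite: SilvermanATAEC1994, IV.9.4 and Table 4.1] [cite: Miller2011LMS, §1 and Def. 1.1] -/
theorem inertBadSignedBranches_inertBadAtThreeIstarZero_of_etaGZValuationAtThree_of_readingsAtThree
    (hGZη : ∀ (W : WeierstrassCurve ℚ) [W.IsElliptic] [W.IsGloballyMinimal],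
      HasSignedLocalType W 3 (.Istar 0) → W.analyticRank = 1 →
      ∀ (V : WeierstrassCurve ℚ) [V.IsElliptic] [V.IsGloballyMinimal] (C : VariableChange ℚ)
        {N : ℕ} [NeZero N] {f : CuspForm (Gamma0 N) 2},
        C • W.quadraticTwist (-3) = V →
        V.HasGoodReductionAtPrime 3 → V.frobeniusTrace 3 = 0 → IsNewformOf V f →
        ∀ (ϖ : ℚ), (ϖ : ℝ) * V.imaginaryPeriodRat = minusPeriod f →
        ∀ (L : IwasawaAlgebra 3), IsQuadraticBranchMinusLFunction f 3 ϖ L →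
        ∀ (P : W.toAffine.Point), ¬ IsOfFinAddOrder P →
        (∀ R : W.toAffine.Point, ∃ (k : ℤ) (T : W.toAffine.Point), IsOfFinAddOrder T ∧ R = k • P + T) →
        ∀ (q : ℚ), W.leadingLCoeff / ((W.realPeriodRat * W.regulator : ℝ) : ℂ) = (q : ℂ) →
        PowerSeries.coeff 1 L ≠ 0 ∧
          ((PowerSeries.coeff 1 L : ℤ_[3]) : ℚ_[3]).valuation =
            2 * (padicLog (W.baseChange ℚ_[3]) (W.toPadicPoint 3 P)).valuation + padicValRat 3 q)
    (h₅ : (∀ (V : WeierstrassCurve ℚ) [V.IsElliptic] [V.IsGloballyMinimal], V.HasCM →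
        V.HasGoodReductionAtPrime 3 → CMInert V 3 → QuadraticBranchPlusMainConjectureAt V 3) ∧
      ∀ (W : WeierstrassCurve ℚ) [W.IsElliptic] [W.IsGloballyMinimal],
        HasSignedLocalType W 3 (.Istar 0) → W.analyticRank = 1 →
        OddBranchStrictMinusNoFiniteSubmoduleAt W 3 ∧
        ∀ (V : WeierstrassCurve ℚ) [V.IsElliptic] [V.IsGloballyMinimal] (C : VariableChange ℚ)
          {N : ℕ} [NeZero N] {f : CuspForm (Gamma0 N) 2},
          (3 : ℕ) ≠ 2 → C • W.quadraticTwist (-3) = V →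
          V.HasGoodReductionAtPrime 3 → V.frobeniusTrace 3 = 0 →
          QuadraticBranchPlusMainConjectureAt V 3 → IsNewformOf V f →
          ∀ (ϖ : ℚ), (ϖ : ℝ) * V.imaginaryPeriodRat = minusPeriod f →
          ∀ (Lη : IwasawaAlgebra 3), IsQuadraticBranchMinusLFunction f 3 ϖ Lη →
          ∀ (κ : ZpExtension ℚ 3) (γ : Field.absoluteGaloisGroup ℚ),
            κ.IsCyclotomic → κ.IsTopGenerator γ → IsCyclotomicVariable 3 γ →
          ∀ (D : StrictSignedSelmerDualData W κ ℚ_[3] γ (-1)) (L' : IwasawaAlgebra 3),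
            Lη = PowerSeries.X * L' → D.charIdeal = Ideal.span {L'})
    (h₆ : PublishedFactsInert) :
    InertBadAtThreeIstarZero := by
  obtain ⟨hmod, hGZ, hGZK, hPT, hnf, hM⟩ := h₆
  obtain ⟨hC1, hRd⟩ := h₅
  intro W _ _ _ hT hr
  exact missingInputAt_IstarZero_three_of_etaGZValuation_of_readings_of_mazur hmod hGZ hGZK hPT hnf hM
    hGZη hRd hC1 W hT hr

end Summit.BirchSwinnertonDyer.BirchSwinnertonDyer.Theorems

end
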